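import Literature.AlgebraicGeometry.Motives.FamiliesVHSMorphism
import HarnessLib

/-!
# Functoriality of morphisms of VHS data under `⊗`, duals and `Hom`: `φ ⊗ ψ`, the transpose `φ^∨`, weight casts, and
# `Hom(φ, ψ) : Hom(D₁, D₂) → Hom(D₁', D₂')` with its action on lattice classes `f ↦ ψ ∘ f ∘ φ`

Topic `Literature/AlgebraicGeometry/Motives` (namespace `Literature.AlgebraicGeometry.Motives.VHSData`), lane `lit-hodgefound` (seat `p08`, row g57-#4).
DEFINITIONS WITH BODIES (`Hom.tensor`, `Hom.dualMap`, `Hom.castMap`, `Hom.homMap`) and their API; no named fact, no instance, no notation (D-0026 net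
debt `0`).  Sequel of `Motives/FamiliesVHSTensor` (`D₁ ⊗ D₂`, g56-#7), `Motives/FamiliesVHSDual` (`D^∨`, g56-#10), `Motives/FamiliesVHSHom` (`Hom(D₁, D₂)`,
`homClass`, `homRat`, `cast`, g56-#11) and `Motives/FamiliesVHSMorphism` (`VHSData.Hom`, g56-#15); the Hodge-theoretic input is the tree's
`HodgeStructure.Hom.tensorMap` (`Motives/HodgeTensorMorphisms`: `f ⊗ g` is a morphism of the tensor Hodge structures) and the dual filtration
`F^p V^∨ = (F^{1−p} V)^⊥` (`Motives/HodgeTensor`).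

PRINTED SOURCES.  P. Deligne, *Équations différentielles à points singuliers réguliers*, LNM 163 (1970), I.1: local systems form a `⊗`-category
with internal `Hom` and duals, all operations FUNCTORIAL and fibrewise.  P. Deligne, *Théorie de Hodge II*, Publ. Math. IHÉS 40 (1971), 1.1.6–1.1.7
(dual filtration), 1.1.12 (`⊗` of filtered objects is functorial), 2.1 (morphisms of Hodge structures).  B. Moonen, *Families of motives and the
Mumford–Tate conjecture*, Milan J. Math. 85 (2017), §2.1 («`HS` is a Tannakian category … tensor products and duals given by the usual
constructions»).  W. Schmid, *Variation of Hodge structure*, Invent. Math. 22 (1973), §2 ∕ P. Griffiths, *Periods of integrals III*, Publ. Math.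
IHÉS 38 (1970), §1: variations are stable under `⊗`, `Hom`, duals, functorially in morphisms of variations.  C. Voisin, *Hodge Theory I*, §7.3.1
(morphisms of variations), Lemma 7.25 (Hodge classes of `Hom`).  N. Bourbaki, *Algebra* II §4 no. 2 (`Hom(M, N) = M^∨ ⊗ N` and its functoriality
`ᵗu ⊗ v`), §5 no. 4 (transpose and extension of scalars).

* §1 (private) complexified transposes read through the tree's `dualBaseChange`; the contraction of `(ᵗf ⊗ g)(z)` is `g ∘ ⟨z⟩ ∘ f`.
* §2 **`Hom.tensor φ ψ : Hom (D₁ ⊗ D₂) (D₁' ⊗ D₂')`** for `φ : D₁ → D₁'` (weight `k₁`), `ψ : D₂ → D₂'` (weight `k₂`): lattice maps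
  `TensorProduct.map φ_s ψ_s` (`homRat_tensorMap`: rationalization `φ_ℚ ⊗ ψ_ℚ`; flat by `TensorProduct.map_comp`; Hodge by the tree's
  `Hom.tensorMap`); `tensor_app`, `tensor_app_tmul`, `tensor_id`, `tensor_comp`, `isHodgeAt_tensor_app_tmul`.
* §3 **`Hom.dualMap φ : Hom D₂^∨ D₁^∨`** (transpose; lattice maps `(φ_s)ᵗ`, `homRat_dualMap`; flat because `φ` intertwines the inverse transports;
  Hodge because `(φ_s)ᵗ_ℂ ξ` kills `F^{1−p} V₁` when `ξ` kills `F^{1−p} V₂ ⊇ φ_ℂ F^{1−p} V₁`); `dualMap_app`, `dualMap_app_apply`, `dualMap_id`,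
  `dualMap_comp`.
* §4 **`Hom.castMap φ h : Hom (D.cast h) (D'.cast h)`** (same lattice maps) and **`Hom.homMap φ ψ : Hom (Hom(D₁, D₂)) (Hom(D₁', D₂'))`** for
  `φ : D₁' → D₁`, `ψ : D₂ → D₂'` (= `(φ^∨ ⊗ ψ).castMap`), with **`homMap_app_homClass`**: `Hom(φ, ψ)_s (homClass f) = homClass (ψ_s ∘ f ∘ φ_s)` —
  so integral Hodge classes of `Hom(D₁, D₂)` (lattice maps respecting the Hodge structures, `isHodgeAt_homClass_iff`) are carried to integral Hodge
  classes of `Hom(D₁', D₂')` (`isHodgeAt_homClass_conj`).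

HONEST SCOPE: as for every `VHSData`, holomorphy ∕ transversality are not recorded; compatibility of morphisms with polarizations is not required
(as in `Motives/FamiliesVHSMorphism`).

## References

* [Deligne1970] P. Deligne, *Équations différentielles à points singuliers réguliers*, LNM 163 (1970), I.1.
* [DeligneHodgeII1971] P. Deligne, *Théorie de Hodge II*, Publ. Math. IHÉS 40 (1971), 1.1.6–1.1.7, 1.1.12, 2.1.
* [Moonen2017FamiliesMotives] B. Moonen, *Families of motives and the Mumford–Tate conjecture*, Milan J. Math. 85 (2017), §2.1.
* [Schmid1973] W. Schmid, *Variation of Hodge structure: the singularities of the period mapping*, Invent. Math. 22 (1973), §2.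
* [Griffiths1970] P. Griffiths, *Periods of integrals on algebraic manifolds III*, Publ. Math. IHÉS 38 (1970), §1.
* [VoisinHodgeI2002] C. Voisin, *Hodge Theory and Complex Algebraic Geometry I*, CUP (2002), §7.3.1, Lemma 7.25.
* [BourbakiAlgebraI1989] N. Bourbaki, *Algebra I*, Ch. II §4 no. 2, §5 no. 4.
-/

noncomputable section

open CategoryTheory
open scoped TensorProduct

namespace Literature.AlgebraicGeometry.Motives

namespace VHSData

variable {S : Type} [TopologicalSpace S] {k k' k₁ k₂ : ℤ}

/-! ## §1 Complexified transposes; contraction of `(ᵗf ⊗ g)(z)` -/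

section Plumbing

variable {R : Type} [CommRing R] {M M' N N' : Type} [AddCommGroup M] [Module R M] [AddCommGroup M'] [Module R M'] [AddCommGroup N] [Module R N]
  [AddCommGroup N'] [Module R N']

/-- `⟨(ᵗf ⊗ g) z⟩ = g ∘ ⟨z⟩ ∘ f`: the contraction `Dual M' ⊗ N' → Hom(M', N')` of the image of `z ∈ Dual M ⊗ N` under `ᵗf ⊗ g` (Bourbaki II §4
no. 2). [cite: BourbakiAlgebraI1989, Ch. II §4 no. 2] -/
private theorem dualTensorHom_map_dualMap (f : M' →ₗ[R] M) (g : N →ₗ[R] N') (z : Module.Dual R M ⊗[R] N) :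
    dualTensorHom R M' N' (TensorProduct.map f.dualMap g z) = g ∘ₗ dualTensorHom R M N z ∘ₗ f := by
  induction z using TensorProduct.induction_on with
  | zero => rw [map_zero, map_zero, map_zero, LinearMap.zero_comp, LinearMap.comp_zero]
  | tmul χ u =>
    refine LinearMap.ext fun m => ?_
    rw [TensorProduct.map_tmul, dualTensorHom_apply, LinearMap.comp_apply, LinearMap.comp_apply, dualTensorHom_apply, map_smul,
      LinearMap.dualMap_apply]
  | add x y hx hy => rw [map_add, map_add, hx, hy, map_add, LinearMap.add_comp, LinearMap.comp_add]

variable {V W : Type} [AddCommGroup V] [Module ℚ V] [AddCommGroup W] [Module ℚ W]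

/-- `(ᵗf)_ℂ ξ` evaluated through `dualBaseChange`: `⟨(ᵗf)_ℂ ξ, x⟩ = ⟨ξ, f_ℂ x⟩` (transpose commutes with extension of scalars; checked on pure
tensors, `dualBaseChange_tmul_tmul`). [cite: BourbakiAlgebraI1989, Ch. II §5 no. 4] -/
private theorem dualBaseChange_dualMap_baseChange_apply (f : V →ₗ[ℚ] W) (ξ : ℂ ⊗[ℚ] Module.Dual ℚ W) (x : ℂ ⊗[ℚ] V) :
    HodgeStructure.dualBaseChange V (f.dualMap.baseChange ℂ ξ) x = HodgeStructure.dualBaseChange W ξ (f.baseChange ℂ x) := by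
  induction ξ using TensorProduct.induction_on with
  | zero => rw [map_zero, map_zero, map_zero, LinearMap.zero_apply, LinearMap.zero_apply]
  | tmul c ψ =>
    induction x using TensorProduct.induction_on with
    | zero => rw [map_zero, map_zero, map_zero]
    | tmul d v =>
      rw [LinearMap.baseChange_tmul, LinearMap.baseChange_tmul, HodgeStructure.dualBaseChange_tmul_tmul, HodgeStructure.dualBaseChange_tmul_tmul,
        LinearMap.dualMap_apply]
    | add x y hx hy => rw [map_add, map_add, map_add, hx, hy]
  | add ξ η hξ hη => rw [map_add, map_add, map_add, LinearMap.add_apply, LinearMap.add_apply, hξ, hη]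

/-- **The transpose of a morphism of Hodge structures respects the dual filtrations**: `(ᵗf)_ℂ (F^p W^∨) ⊆ F^p V^∨` for `f_ℂ (F^q V) ⊆ F^q W` (all `q`)
— `F^p V^∨ = (F^{1−p} V)^⊥` (Deligne, Hodge II 1.1.6–1.1.7; the tree's `mem_dualFiltration_iff`). [cite: DeligneHodgeII1971, 1.1.6–1.1.7]
[cite: Moonen2017FamiliesMotives, §2.1 (p. 3)] -/
private theorem map_dualMap_dualFiltration_le {n : ℤ} (H₁ : HodgeStructure V n) (H₂ : HodgeStructure W n) (f : V →ₗ[ℚ] W)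
    (hf : ∀ q : ℤ, (H₁.F q).map (f.baseChange ℂ) ≤ H₂.F q) (p : ℤ) :
    (H₂.dualFiltration p).map (f.dualMap.baseChange ℂ) ≤ H₁.dualFiltration p := by
  rintro _ ⟨ξ, hξ, rfl⟩
  replace hξ : ξ ∈ H₂.dualFiltration p := hξ
  rw [HodgeStructure.mem_dualFiltration_iff] at hξ ⊢
  intro x hx
  rw [dualBaseChange_dualMap_baseChange_apply]
  exact hξ _ (hf _ ⟨x, hx, rfl⟩)

end Plumbing

/-! ## §2 The tensor product `φ ⊗ ψ` of two morphisms -/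

section Tensor

variable {D₁ D₁' D₁'' : VHSData S k₁} {D₂ D₂' D₂'' : VHSData S k₂}

/-- The rationalization of `φ_s ⊗ ψ_s` is `(φ_s)_ℚ ⊗ (ψ_s)_ℚ` (checked on pure tensors of integral vectors, which span: `TensorProduct.ext'` and
`homRat_unique`). [cite: BourbakiAlgebraI1989, Ch. II §5 no. 4] [cite: Schmid1973, §2] -/
theorem homRat_tensorMap (φ : Hom D₁ D₁') (ψ : Hom D₂ D₂') (s : S) :
    (D₁.tensor D₂).homRat (D₁'.tensor D₂') s (TensorProduct.map (φ.app s) (ψ.app s)) = TensorProduct.map (φ.appRat s) (ψ.appRat s) := by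
  -- both sides of the defining identity as additive maps out of the honest tensor type `V₁,ℤ,s ⊗ V₂,ℤ,s` (never let instance search pick a
  -- `ℤ`-module structure on the tensor product: compose as `AddMonoidHom`s)
  let L : D₁.VZ.fiber s ⊗[ℤ] D₂.VZ.fiber s →+ D₁'.V.fiber s ⊗[ℚ] D₂'.V.fiber s :=
    (TensorProduct.map (φ.appRat s) (ψ.appRat s)).toAddMonoidHom.comp ((D₁.tensor D₂).toRat s)
  let R : D₁.VZ.fiber s ⊗[ℤ] D₂.VZ.fiber s →+ D₁'.V.fiber s ⊗[ℚ] D₂'.V.fiber s :=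
    ((D₁'.tensor D₂').toRat s).comp (TensorProduct.map (φ.app s) (ψ.app s)).toAddMonoidHom
  have key : L = R := AddMonoidHom.ext fun z => by
    induction z using TensorProduct.induction_on with
    | zero => rw [map_zero, map_zero]
    | tmul m₁ m₂ =>
      change TensorProduct.map (φ.appRat s) (ψ.appRat s) ((D₁.tensor D₂).toRat s (m₁ ⊗ₜ[ℤ] m₂)) =
        (D₁'.tensor D₂').toRat s (TensorProduct.map (φ.app s) (ψ.app s) (m₁ ⊗ₜ[ℤ] m₂))
      rw [tensor_toRat_tmul, TensorProduct.map_tmul, TensorProduct.map_tmul, tensor_toRat_tmul, Hom.appRat_toRat, Hom.appRat_toRat]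
    | add x y hx hy => rw [map_add, map_add, hx, hy]
  exact ((D₁.tensor D₂).homRat_unique (D₁'.tensor D₂') s _ _ fun m => DFunLike.congr_fun key m).symm

/-- **The tensor product `φ ⊗ ψ : D₁ ⊗ D₂ → D₁' ⊗ D₂'` of two morphisms of VHS data** (Deligne 1970 I.1: `⊗` is a functor; Schmid §2 ∕ Griffiths
§1): lattice maps `φ_s ⊗ ψ_s`, flat because `(φ_t ⊗ ψ_t) ∘ (γ ⊗ γ) = (γ ⊗ γ) ∘ (φ_s ⊗ ψ_s)`, Hodge because `φ_ℚ ⊗ ψ_ℚ` is a morphism of the tensor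
Hodge structures (the tree's `HodgeStructure.Hom.tensorMap`, Hodge II 1.1.12). [cite: Deligne1970, I.1] [cite: DeligneHodgeII1971, 1.1.12]
[cite: Schmid1973, §2] -/
def Hom.tensor (φ : Hom D₁ D₁') (ψ : Hom D₂ D₂') : Hom (D₁.tensor D₂) (D₁'.tensor D₂') :=
  Hom.ofFlat (fun s => TensorProduct.map (φ.app s) (ψ.app s))
    (fun {s t} γ u => by
      -- `(φ_t ⊗ ψ_t) ∘ (γ ⊗ γ) = (φ_t γ) ⊗ (ψ_t γ) = (γ φ_s) ⊗ (γ ψ_s) = (γ ⊗ γ) ∘ (φ_s ⊗ ψ_s)`, applied to `u` (`TensorProduct.map_map`, the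
      -- applied form of `map_comp`: no composite of maps between tensor types is elaborated here)
      have h₁ := TensorProduct.map_map (φ.app t) (ψ.app t) (D₁.VZ.transport γ) (D₂.VZ.transport γ) u
      have h₂ := TensorProduct.map_map (D₁'.VZ.transport γ) (D₂'.VZ.transport γ) (φ.app s) (ψ.app s) u
      rw [φ.app_comp_transport, ψ.app_comp_transport] at h₁
      exact h₁.trans h₂.symm)
    fun s p => by
      haveI : HodgeTensorFacts.{0, 0} := hodgeTensorFacts_holds
      rw [homRat_tensorMap]
      exact (HodgeStructure.Hom.tensorMap (φ.hodgeHom s) (ψ.hodgeHom s)).map_F_le p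

/-- `φ ⊗ ψ` on lattices is `TensorProduct.map φ_s ψ_s`. [cite: Deligne1970, I.1] -/
@[simp] theorem Hom.tensor_app (φ : Hom D₁ D₁') (ψ : Hom D₂ D₂') (s : S) : (φ.tensor ψ).app s = TensorProduct.map (φ.app s) (ψ.app s) := rfl

/-- `(φ ⊗ ψ)_s (u₁ ⊗ u₂) = φ_s u₁ ⊗ ψ_s u₂`. [cite: Deligne1970, I.1] -/
theorem Hom.tensor_app_tmul (φ : Hom D₁ D₁') (ψ : Hom D₂ D₂') (s : S) (u₁ : D₁.VZ.fiber s) (u₂ : D₂.VZ.fiber s) :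
    (φ.tensor ψ).app s (u₁ ⊗ₜ[ℤ] u₂) = φ.app s u₁ ⊗ₜ[ℤ] ψ.app s u₂ := rfl

/-- `id ⊗ id = id`. [cite: Deligne1970, I.1] -/
theorem Hom.tensor_id : (Hom.id D₁).tensor (Hom.id D₂) = Hom.id (D₁.tensor D₂) :=
  Hom.ext_of_app _ _ fun _ => TensorProduct.map_id

/-- `(φ' ∘ φ) ⊗ (ψ' ∘ ψ) = (φ' ⊗ ψ') ∘ (φ ⊗ ψ)`. [cite: Deligne1970, I.1] [cite: DeligneHodgeII1971, 1.1.12] -/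
theorem Hom.tensor_comp (φ' : Hom D₁' D₁'') (φ : Hom D₁ D₁') (ψ' : Hom D₂' D₂'') (ψ : Hom D₂ D₂') :
    (φ'.comp φ).tensor (ψ'.comp ψ) = (φ'.tensor ψ').comp (φ.tensor ψ) :=
  Hom.ext_of_app _ _ fun s => TensorProduct.map_comp (φ'.app s) (ψ'.app s) (φ.app s) (ψ.app s)

/-- `φ ⊗ ψ` carries the product class `u₁ ⊗ u₂` of Hodge classes of levels `p₁`, `p₂` to the Hodge class `φ_s u₁ ⊗ ψ_s u₂` of level `p₁ + p₂`.
[cite: DeligneHodgeII1971, 1.1.12] [cite: VoisinHodgeI2002, §7.3.1] -/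
theorem Hom.isHodgeAt_tensor_app_tmul (φ : Hom D₁ D₁') (ψ : Hom D₂ D₂') (s : S) {p₁ p₂ : ℤ} {u₁ : D₁.VZ.fiber s} {u₂ : D₂.VZ.fiber s}
    (h₁ : D₁.IsHodgeAt s p₁ u₁) (h₂ : D₂.IsHodgeAt s p₂ u₂) : (D₁'.tensor D₂').IsHodgeAt s (p₁ + p₂) ((φ.tensor ψ).app s (u₁ ⊗ₜ[ℤ] u₂)) :=
  D₁'.isHodgeAt_tensor_tmul D₂' s (φ.isHodgeAt_app h₁) (ψ.isHodgeAt_app h₂)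

end Tensor

/-! ## §3 The transpose `φ^∨ : D₂^∨ → D₁^∨` of a morphism -/

section Dual

variable {D₁ D₂ D₃ : VHSData S k}

/-- The rationalization of the transposed lattice map `ᵗ(φ_s)` is `ᵗ((φ_s)_ℚ)` (both functionals agree on the `ℚ`-spanning image of `V₁,ℤ,s`,
`dual_toRat_apply`). [cite: BourbakiAlgebraI1989, Ch. II §5 no. 4] [cite: Schmid1973, §2] -/
theorem homRat_dualMap (φ : Hom D₁ D₂) (s : S) : D₂.dual.homRat D₁.dual s (φ.app s).dualMap = (φ.appRat s).dualMap := by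
  symm
  refine D₂.dual.homRat_unique D₁.dual s _ _ fun χ => ?_
  refine (D₁.isBaseChange_toRatLinear ⟨s⟩).algHom_ext _ _ fun m => ?_
  change (show Module.Dual ℚ (D₂.V.fiber s) from D₂.dual.toRat s (χ : D₂.dual.VZ.fiber s)) (φ.appRat s (D₁.toRat s m)) =
    (show Module.Dual ℚ (D₁.V.fiber s) from D₁.dual.toRat s ((φ.app s).dualMap χ : D₁.dual.VZ.fiber s)) (D₁.toRat s m)
  rw [Hom.appRat_toRat, D₂.dual_toRat_apply, D₁.dual_toRat_apply, LinearMap.dualMap_apply]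

/-- **The transpose `φ^∨ : D₂^∨ → D₁^∨` of a morphism `φ : D₁ → D₂` of VHS data** (Deligne 1970 I.1: duality is a functor; Moonen §2.1): lattice
maps `ᵗ(φ_s)`, flat because `φ` intertwines the transports (`ᵗγ⁻¹ ∘ ᵗφ_t = ᵗφ_s ∘ ᵗγ⁻¹` from `φ_s ∘ γ⁻¹ = γ⁻¹ ∘ φ_t`), Hodge because `ᵗ(φ_ℚ)_ℂ`
maps `F^p V₂^∨ = (F^{1−p} V₂)^⊥` into `(F^{1−p} V₁)^⊥`. [cite: Deligne1970, I.1] [cite: DeligneHodgeII1971, 1.1.6–1.1.7]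
[cite: Moonen2017FamiliesMotives, §2.1 (p. 3)] -/
def Hom.dualMap (φ : Hom D₁ D₂) : Hom D₂.dual D₁.dual :=
  Hom.ofFlat (fun s => (φ.app s).dualMap)
    (fun {s t} γ χ => by
      change (χ ∘ₗ D₂.VZ.transport γ.symm) ∘ₗ φ.app t = (χ ∘ₗ φ.app s) ∘ₗ D₁.VZ.transport γ.symm
      rw [LinearMap.comp_assoc, LinearMap.comp_assoc, φ.app_comp_transport])
    fun s p => by
      haveI : HodgeTensorFacts.{0, 0} := hodgeTensorFacts_holds
      haveI : Module.Finite ℚ (D₁.V.fiber s) := D₁.finite_fiber s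
      haveI : Module.Finite ℚ (D₂.V.fiber s) := D₂.finite_fiber s
      rw [homRat_dualMap]
      exact map_dualMap_dualFiltration_le (D₁.hodge s) (D₂.hodge s) (φ.appRat s) (φ.map_F_le s) p

/-- `φ^∨` on lattices is the transpose `ᵗ(φ_s)`. [cite: Deligne1970, I.1] -/
@[simp] theorem Hom.dualMap_app (φ : Hom D₁ D₂) (s : S) : φ.dualMap.app s = (φ.app s).dualMap := rfl

/-- `(φ^∨)_s χ = χ ∘ φ_s`. [cite: Deligne1970, I.1] -/
theorem Hom.dualMap_app_apply (φ : Hom D₁ D₂) (s : S) (χ : Module.Dual ℤ (D₂.VZ.fiber s)) :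
    φ.dualMap.app s (χ : D₂.dual.VZ.fiber s) = ((χ ∘ₗ φ.app s : Module.Dual ℤ (D₁.VZ.fiber s)) : D₁.dual.VZ.fiber s) := rfl

/-- `id^∨ = id`. [cite: Deligne1970, I.1] -/
theorem Hom.dualMap_id (D : VHSData S k) : (Hom.id D).dualMap = Hom.id D.dual :=
  Hom.ext_of_app _ _ fun _ => LinearMap.dualMap_id

/-- `(ψ ∘ φ)^∨ = φ^∨ ∘ ψ^∨`. [cite: Deligne1970, I.1] [cite: Moonen2017FamiliesMotives, §2.1 (p. 3)] -/
theorem Hom.dualMap_comp (ψ : Hom D₂ D₃) (φ : Hom D₁ D₂) : (ψ.comp φ).dualMap = φ.dualMap.comp ψ.dualMap :=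
  Hom.ext_of_app _ _ fun _ => rfl

end Dual

/-! ## §4 Weight casts of morphisms; `Hom(φ, ψ) : Hom(D₁, D₂) → Hom(D₁', D₂')` and its action on lattice classes -/

section HomMap

/-- **A morphism transported along an equality of weights** (same lattice maps; the filtrations of `D.cast h` are those of `D`).
[cite: DeligneHodgeII1971, 2.1] -/
def Hom.castMap {D D' : VHSData S k} (φ : Hom D D') (h : k = k') : Hom (D.cast h) (D'.cast h) where
  fZ := φ.fZ
  map_F_le := φ.map_F_le

/-- `castMap` keeps the lattice maps. [cite: DeligneHodgeII1971, 2.1] -/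
@[simp] theorem Hom.castMap_app {D D' : VHSData S k} (φ : Hom D D') (h : k = k') (s : S) : (φ.castMap h).app s = φ.app s := rfl

variable {D₁ D₁' : VHSData S k₁} {D₂ D₂' : VHSData S k₂}

/-- **`Hom(φ, ψ) : Hom(D₁, D₂) → Hom(D₁', D₂')`** for `φ : D₁' → D₁` and `ψ : D₂ → D₂'`: the morphism `φ^∨ ⊗ ψ` of `D₁^∨ ⊗ D₂ → D₁'^∨ ⊗ D₂'`
transported to the weight `k₂ − k₁` of `Hom` (Deligne 1970 I.1: internal `Hom` is a bifunctor; Bourbaki II §4 no. 2: `Hom(u, v) = ᵗu ⊗ v`).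
[cite: Deligne1970, I.1] [cite: BourbakiAlgebraI1989, Ch. II §4 no. 2] [cite: Schmid1973, §2] -/
def Hom.homMap (φ : Hom D₁' D₁) (ψ : Hom D₂ D₂') : Hom (D₁.hom D₂) (D₁'.hom D₂') :=
  (φ.dualMap.tensor ψ).castMap (neg_add_eq_sub k₁ k₂)

/-- `Hom(φ, ψ)` on lattices is `ᵗ(φ_s) ⊗ ψ_s`. [cite: BourbakiAlgebraI1989, Ch. II §4 no. 2] -/
@[simp] theorem Hom.homMap_app (φ : Hom D₁' D₁) (ψ : Hom D₂ D₂') (s : S) :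
    (Hom.homMap φ ψ).app s = TensorProduct.map (φ.app s).dualMap (ψ.app s) := rfl

/-- **`Hom(φ, ψ)_s (homClass f) = homClass (ψ_s ∘ f ∘ φ_s)`**: on the lattice class of a `ℤ`-linear map `f : V₁,ℤ,s → V₂,ℤ,s` the morphism
`Hom(φ, ψ)` acts by pre- and post-composition (`⟨(ᵗφ_s ⊗ ψ_s) z⟩ = ψ_s ∘ ⟨z⟩ ∘ φ_s`, Bourbaki II §4 no. 2).
[cite: BourbakiAlgebraI1989, Ch. II §4 no. 2] [cite: Deligne1970, I.1] -/
theorem Hom.homMap_app_homClass (φ : Hom D₁' D₁) (ψ : Hom D₂ D₂') (s : S) (f : D₁.VZ.fiber s →ₗ[ℤ] D₂.VZ.fiber s) :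
    (Hom.homMap φ ψ).app s (D₁.homClass D₂ s f) = D₁'.homClass D₂' s (ψ.app s ∘ₗ f ∘ₗ φ.app s) := by
  haveI : Module.Free ℤ (D₁'.VZ.fiber s) := D₁'.free s
  haveI : Module.Finite ℤ (D₁'.VZ.fiber s) := D₁'.finite s
  have h := dualTensorHom_map_dualMap (φ.app s) (ψ.app s) (D₁.homClass D₂ s f : Module.Dual ℤ (D₁.VZ.fiber s) ⊗[ℤ] D₂.VZ.fiber s)
  rw [dualTensorHom_homClass] at h
  symm
  change (dualTensorHomEquiv ℤ (D₁'.VZ.fiber s) (D₂'.VZ.fiber s)).symm (ψ.app s ∘ₗ f ∘ₗ φ.app s) = _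
  rw [LinearEquiv.symm_apply_eq, dualTensorHomEquiv, dualTensorHomEquivOfBasis_apply]
  exact h.symm

/-- **`Hom(φ, ψ)` carries integral Hodge classes of `Hom(D₁, D₂)` to integral Hodge classes of `Hom(D₁', D₂')`**: if `f_ℚ` respects the Hodge
structures at `s` then so does `(ψ_s ∘ f ∘ φ_s)_ℚ` (morphisms preserve Hodge classes, `Hom.isHodgeAt_app`, and `homMap_app_homClass`).
[cite: VoisinHodgeI2002, §7.3.1 and Lemma 7.25] [cite: DeligneHodgeII1971, 2.1] -/
theorem isHodgeAt_homClass_conj (φ : Hom D₁' D₁) (ψ : Hom D₂ D₂') (s : S) {f : D₁.VZ.fiber s →ₗ[ℤ] D₂.VZ.fiber s}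
    (hf : (D₁.hom D₂).IsHodgeAt s 0 (D₁.homClass D₂ s f)) : (D₁'.hom D₂').IsHodgeAt s 0 (D₁'.homClass D₂' s (ψ.app s ∘ₗ f ∘ₗ φ.app s)) := by
  rw [← Hom.homMap_app_homClass]
  exact (Hom.homMap φ ψ).isHodgeAt_app hf

/-- Determinations: if the determination `γ_* (homClass f)` at `t` is a Hodge class of `Hom(D₁, D₂)`, then the determination of
`homClass (ψ_s ∘ f ∘ φ_s)` at `t` is a Hodge class of `Hom(D₁', D₂')` — the loci where `f` «stays a morphism of Hodge structures» are functorial.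
[cite: CattaniDeligneKaplan1995, §1] [cite: VoisinHodgeI2002, §7.3.1] -/
theorem isHodgeAt_transport_homClass_conj (φ : Hom D₁' D₁) (ψ : Hom D₂ D₂') {s t : S} (γ : Path.Homotopic.Quotient s t)
    {f : D₁.VZ.fiber s →ₗ[ℤ] D₂.VZ.fiber s} (hf : (D₁.hom D₂).IsHodgeAt t 0 ((D₁.hom D₂).VZ.transport γ (D₁.homClass D₂ s f))) :
    (D₁'.hom D₂').IsHodgeAt t 0 ((D₁'.hom D₂').VZ.transport γ (D₁'.homClass D₂' s (ψ.app s ∘ₗ f ∘ₗ φ.app s))) := by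
  rw [← Hom.homMap_app_homClass]
  exact (Hom.homMap φ ψ).isHodgeAt_transport_app γ hf

end HomMap

end VHSData

end Literature.AlgebraicGeometry.Motives

end
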